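import Literature.Computability.Complexity.GateEliminationCase82Sit
import Literature.Computability.Complexity.GateEliminationCase8Dispatch

/-!
# Gate elimination: the configuration of Case 8.2 after the protected substitution

Case 8.2.2 / 8.2.5 of §4.1 (ECCC TR21-023, p. 31, p. 35): after "`x_k ← d` and normalize the
circuit" (the situation `ProtSubstSit`), "if `x_k` does not feed `Q` in the original circuit,
then `Q` still feeds `G`, and its out-degree does not decrease; otherwise the other input `Q′` of
`Q` is passed to feed `G`. Note that `Q′` is also an ⊕-type gate, so we identify it with `Q`
later", and "`Q` is still a `2⁺`-gate computing affine function which depends on the unprotected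
variable `x_j`" / "Clearly `Q′` is also a `2⁺`-gate depending on an unprotected variable `x_j`".
PROVED here: the dependence of a ⊕-type gate on its variable wire and through its gate wire
(`dependsOn_var_of_reads`, `dependsOn_gate_of_reads`), and `ProtSubstSit.exists_conf` — in the
new circuit `K`, the ∧-type gate `G` reads at the same position a gate `I` of the xor-part
depending on the (now unprotected) `x_j`, of out-degree at least that of `Q`, unless the one-step
conclusion already holds (when `Q` reads `x_k` and a variable, Cases 6.2.2.1–6.2.2.3 apply).

## References

* J. Li, T. Yang, *3.1n − o(n) circuit lower bounds for explicit functions*, STOC 2022;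
  ECCC TR21-023, §4.1 (Cases 8.2.2, 8.2.2.2, 8.2.5), Prop. 2.7.
-/

namespace Literature.Computability.Complexity

open Finset

namespace Semicircuit

variable {n : ℕ} {C : Semicircuit n} {f : (Fin n → ZMod 2) → Bool} {R : RdqSource n} {d : ℕ} {αφ αI αQ : ℝ}

/-- The value of a ⊕-type gate on a solution: the xor of its two wires and its constant. [folklore] -/
theorem sol_eq_xor_of_isXorOp (hF : C.Fair) {Q : Fin C.m} (hQ : IsXorOp (C.op Q)) :
    ∃ c, ∀ xx' : Fin n → Bool, C.sol hF xx' Q =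
      ((C.nodeVal xx' (C.sol hF xx') (C.arg Q 0) ^^ C.nodeVal xx' (C.sol hF xx') (C.arg Q 1)) ^^ c) := by
  obtain ⟨c, hc⟩ := hQ
  refine ⟨c, fun xx' => ?_⟩
  have h := C.consistent_sol hF xx' Q
  rw [hc] at h
  exact h

/-- **A ⊕-type gate of the xor-part depends on a variable it reads** when its other wire is a
variable too (`Q = x_k ⊕ u ⊕ c`). [cite: LiYang2022, Prop. 2.7] -/
theorem dependsOn_var_of_reads_vars (hF : C.Fair) {Q : Fin C.m} (hQK : Q ∈ C.xorPart) {a : Fin 2} {xk u : Fin n}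
    (hQk : C.arg Q a = .var xk) (hQu : C.arg Q a.rev = .var u) (hku : xk ≠ u) : C.DependsOn hF Q u := by
  obtain ⟨c, hc⟩ := C.sol_eq_xor_of_isXorOp hF (C.isXorOp_of_mem Q hQK)
  intro xx h
  rw [hc, hc] at h
  rcases fin2_eq_or_eq_rev 0 a with rfl | h1
  · have h0 : C.arg Q 0 = .var xk := hQk
    have h1 : C.arg Q 1 = .var u := hQu
    rw [h0, h1] at h
    change ((Function.update xx u (!xx u) xk ^^ Function.update xx u (!xx u) u) ^^ c) = ((xx xk ^^ xx u) ^^ c) at h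
    rw [Function.update_of_ne hku, Function.update_self] at h
    revert h; cases xx xk <;> cases xx u <;> cases c <;> decide
  · have ha : a = 1 := h1
    subst ha
    have h0 : C.arg Q 0 = .var u := hQu
    rw [h0, hQk] at h
    change ((Function.update xx u (!xx u) u ^^ Function.update xx u (!xx u) xk) ^^ c) = ((xx u ^^ xx xk) ^^ c) at h
    rw [Function.update_of_ne hku, Function.update_self] at h
    revert h; cases xx xk <;> cases xx u <;> cases c <;> decide

/-- **Dependence passes through a ⊕-type gate to its gate wire**: if `Q = x_k ⊕ Q'' ⊕ c` depends
on `x_j ≠ x_k`, so does `Q''` ("Clearly `Q′` is also a `2⁺`-gate depending on an unprotected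
variable `x_j`"). [cite: LiYang2022, §4.1 (Case 8.2.2.2)] -/
theorem dependsOn_gate_of_reads (hF : C.Fair) {Q Q'' : Fin C.m} (hQK : Q ∈ C.xorPart) {a : Fin 2} {xk xj : Fin n}
    (hQk : C.arg Q a = .var xk) (hQQ : C.arg Q a.rev = .gate Q'') (hjk : xj ≠ xk) (hdep : C.DependsOn hF Q xj) :
    C.DependsOn hF Q'' xj := by
  have hQ''K : Q'' ∈ C.xorPart := C.mem_of_arg_eq Q hQK a.rev Q'' hQQ
  refine C.dependsOn_of_exists hF hQ''K ⟨fun _ => false, fun h => hdep (fun _ => false) ?_⟩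
  obtain ⟨c, hc⟩ := C.sol_eq_xor_of_isXorOp hF (C.isXorOp_of_mem Q hQK)
  rw [hc, hc]
  have key : ∀ (a' : Fin 2), C.nodeVal (Function.update (fun _ : Fin n => false) xj (!false))
      (C.sol hF (Function.update (fun _ : Fin n => false) xj (!false))) (C.arg Q a') =
      C.nodeVal (fun _ : Fin n => false) (C.sol hF fun _ => false) (C.arg Q a') := by
    intro a'
    rcases fin2_eq_or_eq_rev a a' with rfl | rfl
    · rw [hQk]
      show Function.update (fun _ : Fin n => false) xj (!false) xk = false
      rw [Function.update_of_ne hjk.symm]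
    · rw [hQQ]; exact h
  rw [key 0, key 1]

namespace ProtSubstSit

variable (S : C.ProtSubstSit f R αφ αI αQ)

/-- **Out-degree of the other wire of `P_k` when it is a gate**:
`fanout_K = fanout - 1 + fanout(P_k)`. [cite: LiYang2022, §3.3 (Rule 3)] -/
theorem fanout_repl_gate {k' : Fin S.K.m} (hr : C.arg S.Pk S.ak.rev = .gate (S.E.ι k')) :
    S.K.fanout (.gate k') + 1 = C.fanout (.gate (S.E.ι k')) + C.fanout (.gate S.Pk) := by
  classical
  have h := S.E.fanout_repl_add
  rw [S.hrepl, hr, S.E.pull_ι] at h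
  have hc1 : (univ.filter fun a' : Fin 2 => S.C₀.arg S.Pk a' = .gate (S.E.ι k')).card = 1 := by
    rw [card_eq_one]
    refine ⟨S.ak.rev, ?_⟩
    ext a'
    simp only [mem_filter, mem_univ, true_and, mem_singleton]
    constructor
    · intro h'
      have h'' := Node.substConst_eq_gate_iff.mp h'
      rcases fin2_eq_or_eq_rev S.ak a' with rfl | rfl
      · rw [S.hPk] at h''; cases h''
      · rfl
    · rintro rfl
      show (C.arg S.Pk S.ak.rev).substConst S.xk _ = _
      rw [hr]; rfl
  rw [hc1, C.fanout_substConst_gate, C.fanout_substConst_gate] at h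
  exact h

/-- **The configuration of Case 8.2 in the new circuit** (Cases 8.2.2, 8.2.5: "`Q` still feeds
`G`, and its out-degree does not decrease; otherwise the other input `Q′` of `Q` is passed to feed
`G` … we identify it with `Q` later"; "`Q` is still a `2⁺`-gate computing affine function which
depends on the unprotected variable `x_j`"): for the ∧-type gate `G` reading the gate `Q` of the
xor-part that depends on `x_j`, either the one-step conclusion holds for `C` (when `Q` reads `x_k`
and a variable: that variable is one `Q` depends on, protected, a `1`-variable —
Cases 6.2.2.1–6.2.2.3), or in `K` the gate `G` reads at the same position a gate `I` of the
xor-part depending on `x_j`, of out-degree at least that of `Q`, which is `Q` itself or the gate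
wire of `Q = P_k`. [cite: LiYang2022, §4.1 (Cases 8.2.2, 8.2.2.2, 8.2.5)] -/
theorem exists_conf (hf : IsAffineDisperser f d) (hd : 2 * d + 2 < R.dim) (hF : C.Fair)
    (hC : C.ComputesRestr f R) (hS : C.Standing R) (hφ : 0 ≤ αφ) (hφ2 : αφ ≤ 1 / 2) (hI : 0 ≤ αI) (hQ : 0 ≤ αQ)
    {G Q : Fin C.m} {aQ : Fin 2} (hand : IsAndOp (C.op G)) (hGQ : C.arg G aQ = .gate Q) (hQK : Q ∈ C.xorPart)
    (hprot : ∀ x, C.DependsOn hF Q x → R.Protected x) (hdepj : C.DependsOn hF Q S.xj) :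
    C.StepGoal f R αφ αI αQ ∨
    ∃ (kG I : Fin S.K.m), S.E.ι kG = G ∧ IsAndOp (S.K.op kG) ∧ S.K.arg kG aQ = .gate I ∧ I ∈ S.K.xorPart ∧
      S.K.DependsOn S.fair I S.xj ∧ C.fanout (.gate Q) ≤ S.K.fanout (.gate I) ∧
      (S.E.ι I = Q ∨ (Q = S.Pk ∧ C.arg Q S.ak.rev = .gate (S.E.ι I))) := by
  classical
  have hN := hS.normalized.1
  have hPkxor : IsXorOp (C.op S.Pk) := hS.isXorOp_of_protected S.protected_xk S.hPk
  have hGPk : G ≠ S.Pk := fun h => not_isAndOp_of_isXorOp hPkxor (h ▸ hand)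
  obtain ⟨kG, hkG⟩ := S.E.ι_surj G hGPk
  have handK : IsAndOp (S.K.op kG) := by rw [S.E.isAndOp_iff, hkG]; exact hand
  by_cases hQP : Q = S.Pk
  · -- `Q = P_k` reads `x_k`; its other wire
    cases hr : C.arg S.Pk S.ak.rev with
    | const b => exact absurd hr (hN.arg_ne_const _ _ _)
    | var u =>
      -- `Q = x_k ⊕ u ⊕ c` depends on `u`, which is then protected: Cases 6.2.2.x
      left
      have hku : S.xk ≠ u := fun h => hN.arg_ne_arg_rev S.Pk S.ak (by rw [S.hPk, hr, h])
      have hdepu : C.DependsOn hF S.Pk u := dependsOn_var_of_reads_vars hF (hQP ▸ hQK) S.hPk hr hku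
      have hup : R.Protected u := hprot u (hQP ▸ hdepu)
      have hu1 : C.fanout (.var u) = 1 := hS.fanout_eq_one_of_protected hup hr
      exact case6_2_2_oneVar hf hd hF hC hS hφ hφ2 hI hQ S.hPk hr S.protected_xk hu1
    | gate Q'' =>
      right
      have hQ''K : Q'' ∈ C.xorPart := C.mem_of_arg_eq S.Pk (hQP ▸ hQK) S.ak.rev Q'' hr
      have hQ''P : Q'' ≠ S.Pk := fun h => by
        rw [h] at hr; exact not_reads_self_of_standing hF hN hS.nonDegenerate S.Pk S.ak.rev hr
      obtain ⟨kI, hkI⟩ := S.E.ι_surj Q'' hQ''P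
      have hargI : S.K.arg kG aQ = .gate kI := by
        rw [S.E.arg_eq_gate_iff, hkG, hkI, S.arg_C₀_of_ne hS hGPk, S.hrepl, hr]
        exact Or.inr ⟨hQP ▸ hGQ, rfl⟩
      have hIK : kI ∈ S.K.xorPart := (S.mem_xorPart_iff kI).mpr (hkI ▸ hQ''K)
      have hdepQ'' : C.DependsOn hF Q'' S.xj :=
        dependsOn_gate_of_reads hF (hQP ▸ hQK) S.hPk hr S.xj_ne_xk (hQP ▸ hdepj)
      have hdepI : S.K.DependsOn S.fair kI S.xj := S.dependsOn hF hIK S.xj_ne_xk (hkI ▸ hdepQ'')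
      -- out-degree: `fanout_K(Q'') = fanout(Q'') - 1 + fanout(Q) ≥ fanout(Q)`
      have hfan : C.fanout (.gate Q) ≤ S.K.fanout (.gate kI) := by
        have h := S.fanout_repl_gate (k' := kI) (by rw [hkI]; exact hr)
        have h1 : 1 ≤ C.fanout (.gate (S.E.ι kI)) := one_le_fanout_of_arg_eq (by rw [hkI]; exact hr)
        rw [hQP]; omega
      exact ⟨kG, kI, hkG, handK, hargI, hIK, hdepI, hfan, Or.inr ⟨hQP, by rw [hQP, hkI]; exact hr⟩⟩
  · right
    obtain ⟨kI, hkI⟩ := S.E.ι_surj Q hQP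
    have hargI : S.K.arg kG aQ = .gate kI := S.arg_eq_gate hS (by rw [hkG, hkI]; exact hGQ)
    have hIK : kI ∈ S.K.xorPart := (S.mem_xorPart_iff kI).mpr (hkI ▸ hQK)
    have hdepI : S.K.DependsOn S.fair kI S.xj := S.dependsOn hF hIK S.xj_ne_xk (hkI ▸ hdepj)
    have hfan : C.fanout (.gate Q) ≤ S.K.fanout (.gate kI) := by
      by_cases hrQ : C.arg S.Pk S.ak.rev = .gate Q
      · -- `P_k` reads `Q`: `fanout_K(Q) = fanout(Q) - 1 + fanout(P_k)` and `P_k` is not the output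
        have h := S.fanout_repl_gate (k' := kI) (by rw [hkI]; exact hrQ)
        rw [hkI] at h
        have hPpos : 0 < C.fanout (.gate S.Pk) :=
          fanout_pos_of_protected_reader hf (by omega) hF hC hS S.hPk S.protected_xk (fun k hk => by
            rw [hrQ] at hk; cases hk; exact hQK)
        omega
      · have h := S.fanout_gate_add (k' := kI) (by rw [hkI]; exact hrQ)
        have hc0 : (univ.filter fun a' : Fin 2 => C.arg S.Pk a' = .gate (S.E.ι kI)).card = 0 := by
          rw [card_eq_zero, filter_eq_empty_iff]
          intro a' _ h'
          rcases fin2_eq_or_eq_rev S.ak a' with rfl | rfl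
          · rw [S.hPk] at h'; cases h'
          · rw [hkI] at h'; exact hrQ h'
        rw [hc0, hkI] at h
        omega
    exact ⟨kG, kI, hkG, handK, hargI, hIK, hdepI, hfan, Or.inl hkI⟩

end ProtSubstSit

end Semicircuit

end Literature.Computability.Complexity
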